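import Literature.NumberTheory.LFunctions.HalaszRestrictedWindow
import Literature.NumberTheory.LFunctions.MatomakiRadziwillTaoPropA3
import HarnessLib

/-!
# Matomäki–Radziwiłł–Tao 2015, Proposition A.3: the window around the minimising twist for `F`

Topic `Literature/NumberTheory/LFunctions`.  Everything in this file is PROVED (the final theorem conditionally on
the named fact `Khale2024_zeroFreeRegion`); no definitions, no named facts.

K. Matomäki, M. Radziwiłł, T. Tao, *An averaged form of Chowla's conjecture*, Algebra & Number Theory 9 (2015),
Appendix A, Proposition A.3 bounds `∫_0^T |F(1+it)|² dt`, `F(1+it) = ∑_{X ≤ n ≤ 2X, n ∈ 𝒮} f(n) n^{-1-it}`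
(`MRT2015.restrDirichlet f I X t`, `𝒮 = I.Mem` for an interval system `I : SieveIntervalSystem η X₀`), by splitting
`[0, T]` into `𝒯₂ = {|t - t₁| ≥ (log X)^{1/16}}` and the window `𝒯₀ ∪ 𝒯₁ = {|t - t₁| ≤ (log X)^{1/16}}` around
the minimiser `t₁` of `u ↦ 𝔻(f, n^{iu}; X)²`.  This file specialises the block-system window theorem
`Halasz.Restricted.integral_sq_restr_dirichlet_window_le` (`HalaszRestrictedWindow.lean`) to the interval systems
of Appendix A and simplifies its error terms:

* `MRT2015.memBlocks_iff_mem`, `MRT2015.restrDirichlet_eq_sum_memBlocks` — `𝒮` is the block condition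
  `Halasz.Restricted.MemBlocks` for the blocks `{p prime : ⌈P_j⌉ ≤ p ≤ ⌊Q_j⌋}`, `1 ≤ j ≤ J`, and `F` is the
  block-restricted sum of `HalaszRestrictedDirichlet.lean`;
* `MRT2015.isBlockSystem`, `MRT2015.primeBlock_le_Q_J`, `MRT2015.Q_lt_P_of_lt` — these blocks are pairwise
  disjoint sets of primes `≤ Q_J` (`0 < η ≤ 8`);
* `MRT2015.J_add_one_le` — `J + 1 ≤ 3 + log log X₀` (`0 < η ≤ 1`, `X₀ ≥ e`): by (A-2), `log Q_j ≥ 44 · 32^{j-2}`;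
* `MRT2015.window_errTerms_le` and three elementary inequalities — with `λ = log log X`, `L = (log X)^{1/16}`,
  `Q = exp(√log X)`: `1/L + (J+1)ρ + L(((J+1)ρ)² + u²) ≤ (250 + 16e⁶)(log X)^{-1/50}`;
* `MRT2015.integral_sq_restrDirichlet_window_le` — **the window bound**: assuming Khale's theorem, for an
  absolute `K`, all large `X`, `0 < η ≤ 1`, `√X ≤ X₀ ≤ X`, completely multiplicative `f` with `|f| ≤ 1`, a
  minimiser `t₁` (`𝔻(f, n^{it₁}; X)² ≤ M(f;X)`) and `[a, b] ⊆ [t₁ - (log X)^{1/16}, t₁ + (log X)^{1/16}] ∩ [-X/2, X/2]`,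
  `∫_a^b |F(1+it)|² dt ≤ K ((1 + M) e^{-M/2} + (log X)^{-1/50})`, `M = M(f; X) = minPretentiousDistSq f X X`.

This is the `𝒯₀ ∪ 𝒯₁` half of the restricted-Halász form `MRT2015.PropA3With (fun M => C (1 + M) e^{-M/2})` of
Proposition A.3 (`MatomakiRadziwillTaoPropA3With.lean`; the reduction to `T ≤ X/2` is the mean value theorem, as
printed), which implies Theorem A.2 in the same form, Matomäki–Radziwiłł–Tao's Theorem 1.7 with saving
`exp(-M/120)` and Tao's logarithmically averaged Elliott and Chowla theorems
(`TaoLogElliottProp24OfPropA3With.lean`).  The other half, `𝒯₂`, is Lemma A.4 and Matomäki–Radziwiłł's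
Proposition 1 (§8) for complex `f` and restricted sums, not treated here.

## References
* K. Matomäki, M. Radziwiłł, T. Tao, Algebra & Number Theory 9 (2015) 2167–2196 (arXiv:1503.05121), Appendix A:
  the interval systems (A-1), (A-2), the set `𝒮`, Proposition A.3 and its proof (p. 13).
  [cite: MatomakiRadziwillTao2015, Appendix A, Proposition A.3 (proof)]
* K. Matomäki, M. Radziwiłł, Ann. of Math. 183 (2016), §2 (the intervals `[P_j, Q_j]`).
  [cite: MatomakiRadziwillAnnals2016, §2]
* T. Khale, Q. J. Math. 75 (2024), Theorem 1.1. [cite: Khale2024, Theorem 1.1]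

## Design choices
* No new definitions: the blocks are written inline as `fun j => (Finset.Icc ⌈I.P j⌉₊ ⌊I.Q j⌋₊).filter Nat.Prime`
  on the index set `Finset.Icc 1 I.J`.
* `θ = 7/10` and `δ = 0` are fixed in the final theorem; constants are absolute and crude
  (`K = (250 + 16 e⁶) K_window`), thresholds `∀ᶠ X in atTop` uniform in `η`, `X₀`, `I`, `f`.
-/

noncomputable section

open Finset Real Complex Filter MeasureTheory
open scoped ComplexConjugate Classical

namespace Literature.NumberTheory.LFunctions

namespace MRT2015

open Sieve (SieveIntervalSystem minPretentiousDistSq minPretentiousDistSq_nonneg pretentiousDistSq)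
open Halasz.Restricted (MemBlocks IsBlockSystem)

variable {η X₀ : ℝ}

/-! ### The interval system of Appendix A as a block system -/

/-- `Q_i < P_j` for `1 ≤ i < j` (the intervals increase). [cite: MatomakiRadziwillAnnals2016, §2] -/
theorem Q_lt_P_of_lt (I : SieveIntervalSystem η X₀) (hη : 0 < η) (hη' : η ≤ 8) {i j : ℕ} (hi : 1 ≤ i)
    (hij : i < j) : I.Q i < I.P j := by
  induction j, hij using Nat.le_induction with
  | base => exact I.Q_lt_P_succ hη hη' hi
  | succ j hj ih =>
    exact (ih.trans_le (I.P_le_Q j (by omega))).trans (I.Q_lt_P_succ hη hη' (by omega))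

/-- `Q_j ≤ Q_J` for `1 ≤ j ≤ J`. [folklore] -/
theorem Q_le_Q_J (I : SieveIntervalSystem η X₀) (hη : 0 < η) (hη' : η ≤ 8) {j : ℕ} (hj : 1 ≤ j) (hjJ : j ≤ I.J) :
    I.Q j ≤ I.Q I.J := by
  rcases eq_or_lt_of_le hjJ with h | h
  · rw [h]
  · exact (I.Q_lt_Q hη hη' hj h).le

/-- Membership in the `j`-th block of primes `[P_j, Q_j]` (`j ≥ 1`): `p` prime with `P_j ≤ p ≤ Q_j`. [folklore] -/
theorem mem_primeBlock_iff (I : SieveIntervalSystem η X₀) {j : ℕ} (hj : 1 ≤ j) {p : ℕ} :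
    p ∈ (Finset.Icc ⌈I.P j⌉₊ ⌊I.Q j⌋₊).filter Nat.Prime ↔ p.Prime ∧ I.P j ≤ (p : ℝ) ∧ (p : ℝ) ≤ I.Q j := by
  rw [Finset.mem_filter, Finset.mem_Icc, Nat.ceil_le, Nat.le_floor_iff (I.pos_Q hj).le]
  tauto

/-- **`𝒮` as a block condition**: for `n ≠ 0`, `n ∈ 𝒮` (`I.Mem n`: a prime factor in each `[P_j, Q_j]`, `j ≤ J`)
iff `n` has a prime factor in each block `{p prime : ⌈P_j⌉ ≤ p ≤ ⌊Q_j⌋}`, `j ∈ [1, J]`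
(`Halasz.Restricted.MemBlocks`). [cite: MatomakiRadziwillTao2015, Appendix A] -/
theorem memBlocks_iff_mem (I : SieveIntervalSystem η X₀) {n : ℕ} (hn : n ≠ 0) :
    MemBlocks (Finset.Icc 1 I.J) (fun j => (Finset.Icc ⌈I.P j⌉₊ ⌊I.Q j⌋₊).filter Nat.Prime) n ↔ I.Mem n := by
  unfold MemBlocks SieveIntervalSystem.Mem
  refine forall₂_congr fun j hj => ?_
  rw [Finset.mem_Icc] at hj
  constructor
  · rintro ⟨p, hp, hpn⟩
    rw [mem_primeBlock_iff I hj.1] at hp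
    exact ⟨p, Nat.mem_primeFactors.2 ⟨hp.1, hpn, hn⟩, hp.2.1, hp.2.2⟩
  · rintro ⟨p, hp, h1, h2⟩
    rw [Nat.mem_primeFactors] at hp
    exact ⟨p, (mem_primeBlock_iff I hj.1).2 ⟨hp.1, h1, h2⟩, hp.2.1⟩

/-- The restricted Dirichlet polynomial of Proposition A.3 is the block-restricted sum of
`HalaszRestrictedDirichlet.lean` (`X > 0`). [folklore] -/
theorem restrDirichlet_eq_sum_memBlocks (f : ℕ → ℂ) (I : SieveIntervalSystem η X₀) {X : ℝ} (hX : 0 < X) (t : ℝ) :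
    restrDirichlet f I X t = ∑ n ∈ (Finset.Icc ⌈X⌉₊ ⌊2 * X⌋₊).filter
        (MemBlocks (Finset.Icc 1 I.J) (fun j => (Finset.Icc ⌈I.P j⌉₊ ⌊I.Q j⌋₊).filter Nat.Prime)),
      f n * (n : ℂ) ^ (-(1 + (t : ℂ) * Complex.I)) := by
  unfold restrDirichlet
  refine Finset.sum_congr (Finset.filter_congr fun n hn => ?_) fun _ _ => rfl
  rw [Finset.mem_Icc] at hn
  have h1 : 1 ≤ ⌈X⌉₊ := Nat.one_le_iff_ne_zero.2 (by simpa using hX)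
  exact (memBlocks_iff_mem I (by omega)).symm

/-- The blocks form a block system of primes `≤ N` as soon as `Q_J ≤ N` (`0 < η ≤ 8`: the intervals are
disjoint). [folklore] -/
theorem isBlockSystem (I : SieveIntervalSystem η X₀) (hη : 0 < η) (hη' : η ≤ 8) {N : ℕ} (hN : I.Q I.J ≤ N) :
    IsBlockSystem (Finset.Icc 1 I.J) (fun j => (Finset.Icc ⌈I.P j⌉₊ ⌊I.Q j⌋₊).filter Nat.Prime) N := by
  refine ⟨fun j hj p hp => ?_, fun i hi j hj hij => ?_⟩
  · rw [Finset.mem_Icc] at hj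
    rw [mem_primeBlock_iff I hj.1] at hp
    rw [Nat.mem_primesBelow]
    refine ⟨?_, hp.1⟩
    have : (p : ℝ) ≤ N := (hp.2.2.trans (Q_le_Q_J I hη hη' hj.1 hj.2)).trans hN
    have : p ≤ N := by exact_mod_cast this
    omega
  · rw [Finset.mem_Icc] at hi hj
    rw [Finset.disjoint_left]
    intro p hpi hpj
    rw [mem_primeBlock_iff I hi.1] at hpi
    rw [mem_primeBlock_iff I hj.1] at hpj
    rcases lt_or_gt_of_ne hij with h | h
    · have := Q_lt_P_of_lt I hη hη' hi.1 h; linarith [hpi.2.2, hpj.2.1]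
    · have := Q_lt_P_of_lt I hη hη' hj.1 h; linarith [hpj.2.2, hpi.2.1]

/-- The block primes are `≤ Q_J`. [folklore] -/
theorem primeBlock_le_Q_J (I : SieveIntervalSystem η X₀) (hη : 0 < η) (hη' : η ≤ 8) :
    ∀ j ∈ Finset.Icc 1 I.J, ∀ p ∈ (Finset.Icc ⌈I.P j⌉₊ ⌊I.Q j⌋₊).filter Nat.Prime, (p : ℝ) ≤ I.Q I.J := by
  intro j hj p hp
  rw [Finset.mem_Icc] at hj
  rw [mem_primeBlock_iff I hj.1] at hp
  exact hp.2.2.trans (Q_le_Q_J I hη hη' hj.1 hj.2)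

/-- **The number of intervals is small**: `J + 1 ≤ 3 + log log X₀` (`0 < η ≤ 1`, `X₀ ≥ e`).  Indeed (A-2) with
`η ≤ 1` gives `log Q_j ≥ log P_j ≥ 32 log Q_{j-1} + 64 log j` for `j ≥ 2`, so `log Q_j ≥ 44 · 32^{j-2}`, while
`log Q_J ≤ √(log X₀)`. [cite: MatomakiRadziwillTao2015, Appendix A] -/
theorem J_add_one_le (I : SieveIntervalSystem η X₀) (hη : 0 < η) (hη1 : η ≤ 1) (hX₀ : Real.exp 1 ≤ X₀) :
    (I.J : ℝ) + 1 ≤ 3 + Real.log (Real.log X₀) := by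
  have hη8 : η ≤ 8 := by linarith
  have hX₀0 : 0 < X₀ := (Real.exp_pos 1).trans_le hX₀
  have hlogX₀ : 1 ≤ Real.log X₀ := by
    rw [← Real.log_exp 1]; exact Real.log_le_log (Real.exp_pos 1) hX₀
  have hll0 : 0 ≤ Real.log (Real.log X₀) := Real.log_nonneg hlogX₀
  have hlog2 : (0.6931471803 : ℝ) < Real.log 2 := Real.log_two_gt_d9
  -- the growth of `log Q_j`
  have hcoef : ∀ k : ℕ, 2 ≤ k → η / (k : ℝ) ^ 2 ≤ 1 / 4 := by
    intro k hk
    have hk2 : (2 : ℝ) ≤ k := by exact_mod_cast hk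
    rw [div_le_div_iff₀ (by positivity) (by norm_num)]
    nlinarith
  have hstep : ∀ k : ℕ, 2 ≤ k → 32 * Real.log (I.Q (k - 1)) + 64 * Real.log k ≤ Real.log (I.Q k) := by
    intro k hk
    have h3 := I.notTooClose k hk
    have hQ1 : 0 ≤ Real.log (I.Q (k - 1)) := Real.log_nonneg (I.one_le_Q hη hη8 (by omega))
    have hlogk : 0 ≤ Real.log k := Real.log_nonneg (by exact_mod_cast (by omega : 1 ≤ k))
    have hPpos : 0 < I.P k := I.pos_P k (by omega)
    have hlogP : 0 ≤ Real.log (I.P k) := by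
      by_contra hneg
      push Not at hneg
      have : η / (k : ℝ) ^ 2 * Real.log (I.P k) ≤ 0 :=
        mul_nonpos_of_nonneg_of_nonpos (by positivity) hneg.le
      have hk2 : (2 : ℝ) ≤ k := by exact_mod_cast hk
      have : 0 < Real.log (k : ℝ) := Real.log_pos (by linarith)
      linarith
    have h4 : η / (k : ℝ) ^ 2 * Real.log (I.P k) ≤ 1 / 4 * Real.log (I.P k) :=
      mul_le_mul_of_nonneg_right (hcoef k hk) hlogP
    have hPQ : Real.log (I.P k) ≤ Real.log (I.Q k) := Real.log_le_log hPpos (I.P_le_Q k (by omega))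
    linarith
  have hgrow : ∀ j : ℕ, 2 ≤ j → (44 : ℝ) * 32 ^ (j - 2) ≤ Real.log (I.Q j) := by
    intro j hj
    induction j, hj using Nat.le_induction with
    | base =>
      have h := hstep 2 le_rfl
      have hQ1 : 0 ≤ Real.log (I.Q (2 - 1)) := Real.log_nonneg (I.one_le_Q hη hη8 (by norm_num))
      have : Real.log ((2 : ℕ) : ℝ) = Real.log 2 := by norm_num
      rw [this] at h
      norm_num
      linarith
    | succ j hj ih =>
      have h := hstep (j + 1) (by omega)
      simp only [Nat.add_sub_cancel] at h
      have hlogj : 0 ≤ Real.log ((j + 1 : ℕ) : ℝ) := Real.log_nonneg (by exact_mod_cast (by omega : 1 ≤ j + 1))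
      have hpow : (32 : ℝ) ^ (j + 1 - 2) = 32 ^ (j - 2) * 32 := by
        rw [show j + 1 - 2 = (j - 2) + 1 by omega, pow_succ]
      rw [hpow]
      nlinarith [pow_pos (by norm_num : (0:ℝ) < 32) (j - 2)]
  -- conclusion
  rcases eq_or_lt_of_le I.one_le_J with hJ | hJ
  · rw [← hJ]; norm_num; linarith
  · have hJ2 : 2 ≤ I.J := hJ
    have h1 := hgrow I.J hJ2
    have h2 : Real.log (I.Q I.J) ≤ Real.sqrt (Real.log X₀) := by
      have := Real.log_le_log (I.pos_Q (by omega)) I.Q_J_le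
      rwa [Real.log_exp] at this
    set s : ℝ := Real.sqrt (Real.log X₀) with hs
    have hs44 : 44 ≤ s := by
      have : (1 : ℝ) ≤ 32 ^ (I.J - 2) := one_le_pow₀ (by norm_num)
      nlinarith
    have hpow_le : (32 : ℝ) ^ (I.J - 2) ≤ s := by
      have : (1 : ℝ) ≤ 32 ^ (I.J - 2) := one_le_pow₀ (by norm_num)
      nlinarith
    have hlog32 : 1 ≤ Real.log 32 := by
      rw [← Real.log_exp 1]
      exact Real.log_le_log (Real.exp_pos 1) (by have := Real.exp_one_lt_d9; linarith)
    have h3 : ((I.J - 2 : ℕ) : ℝ) * Real.log 32 ≤ Real.log s := by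
      rw [← Real.log_pow]
      exact Real.log_le_log (by positivity) hpow_le
    have h4 : Real.log s = Real.log (Real.log X₀) / 2 := by
      rw [hs, Real.log_sqrt (by linarith)]
    have h5 : ((I.J - 2 : ℕ) : ℝ) = (I.J : ℝ) - 2 := by
      rw [Nat.cast_sub hJ2]; norm_num
    have h6 : (I.J : ℝ) - 2 ≤ Real.log (Real.log X₀) / 2 := by
      have h0 : 0 ≤ (I.J : ℝ) - 2 := by
        have : (2 : ℝ) ≤ I.J := by exact_mod_cast hJ2
        linarith
      rw [h5] at h3
      nlinarith
    linarith

/-! ### Elementary estimates for the error terms -/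

/-- `3 + λ ≤ 10 e^{λ/10}` (`e^y ≥ 1 + y`). [folklore] -/
theorem three_add_le_exp (lam : ℝ) : 3 + lam ≤ 10 * Real.exp (lam / 10) := by
  have := Real.add_one_le_exp (lam / 10)
  linarith

/-- `((1 + x) e^{-x})² ≤ 16 e^{-3x/2}` for `x ≥ 0` (`(1 + x) e^{-x/4} ≤ 4`). [folklore] -/
theorem sq_one_add_mul_exp_neg_le {x : ℝ} (hx : 0 ≤ x) :
    ((1 + x) * Real.exp (-x)) ^ 2 ≤ 16 * Real.exp (-(3 / 2 * x)) := by
  have h1 : 1 + x ≤ 4 * Real.exp (x / 4) := by linarith [Real.add_one_le_exp (x / 4)]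
  have hfac : 4 * Real.exp (-(3 / 4 * x)) = 4 * Real.exp (x / 4) * Real.exp (-x) := by
    rw [mul_assoc, ← Real.exp_add]; ring_nf
  have h0 : 0 ≤ (1 + x) * Real.exp (-x) := by positivity
  have h2 : (1 + x) * Real.exp (-x) ≤ 4 * Real.exp (-(3 / 4 * x)) := by
    rw [hfac]; exact mul_le_mul_of_nonneg_right h1 (Real.exp_pos _).le
  calc ((1 + x) * Real.exp (-x)) ^ 2 ≤ (4 * Real.exp (-(3 / 4 * x))) ^ 2 := pow_le_pow_left₀ h0 h2 2
    _ = 16 * Real.exp (-(3 / 2 * x)) := by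
        rw [mul_pow, sq (Real.exp _), ← Real.exp_add]; ring_nf

/-- `√((√ℓ + 2)/ℓ) ≤ √2 e^{-(log ℓ)/4}` for `ℓ ≥ 4` (`√ℓ + 2 ≤ 2√ℓ`, `1/√ℓ = e^{-(log ℓ)/2}`). [folklore] -/
theorem sqrt_ratio_le {ℓ : ℝ} (hℓ : 4 ≤ ℓ) :
    Real.sqrt ((Real.sqrt ℓ + 2) / ℓ) ≤ Real.sqrt 2 * Real.exp (-(Real.log ℓ / 4)) := by
  have hℓ0 : 0 < ℓ := by linarith
  have hs2 : 2 ≤ Real.sqrt ℓ := by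
    rw [show (2 : ℝ) = Real.sqrt 4 by rw [show (4:ℝ) = 2 ^ 2 by norm_num, Real.sqrt_sq (by norm_num)]]
    exact Real.sqrt_le_sqrt hℓ
  have hs0 : 0 < Real.sqrt ℓ := by linarith
  have hexp : Real.exp (-(Real.log ℓ / 4)) = 1 / Real.sqrt (Real.sqrt ℓ) := by
    rw [Real.sqrt_eq_rpow, Real.sqrt_eq_rpow, ← Real.rpow_mul hℓ0.le, Real.rpow_def_of_pos hℓ0, one_div,
      ← Real.exp_neg]
    congr 1; ring
  have hratio : (Real.sqrt ℓ + 2) / ℓ ≤ 2 / Real.sqrt ℓ := by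
    rw [div_le_div_iff₀ hℓ0 hs0]
    have : Real.sqrt ℓ * Real.sqrt ℓ = ℓ := Real.mul_self_sqrt hℓ0.le
    nlinarith
  calc Real.sqrt ((Real.sqrt ℓ + 2) / ℓ) ≤ Real.sqrt (2 / Real.sqrt ℓ) := Real.sqrt_le_sqrt hratio
    _ = Real.sqrt 2 * (1 / Real.sqrt (Real.sqrt ℓ)) := by
        rw [Real.sqrt_div (by norm_num : (0:ℝ) ≤ 2)]; ring
    _ = Real.sqrt 2 * Real.exp (-(Real.log ℓ / 4)) := by rw [hexp]

/-- **The error terms of the window bound are `≪ (log X)^{-1/50}`.**  With `λ = log log X ≥ 0`,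
`L = e^{λ/16} = (log X)^{1/16}`: if `J + 1 ≤ 3 + λ`, `ρ ≤ √2 e^{-λ/4}` and `u² ≤ 16 e^6 e^{-9λ/80}`, then
`1/L + (J+1)ρ + L(((J+1)ρ)² + u²) ≤ (250 + 16e^6) e^{-λ/50}`. [folklore] -/
theorem window_errTerms_le {lam Jr ρ u2 : ℝ} (hlam : 0 ≤ lam) (hJr0 : 0 ≤ Jr) (hJr : Jr ≤ 3 + lam) (hρ0 : 0 ≤ ρ)
    (hρ : ρ ≤ Real.sqrt 2 * Real.exp (-(lam / 4)))
    (hu : u2 ≤ 16 * Real.exp 6 * Real.exp (-(9 / 80 * lam))) :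
    1 / Real.exp (lam / 16) + Jr * ρ + Real.exp (lam / 16) * ((Jr * ρ) ^ 2 + u2) ≤
      (250 + 16 * Real.exp 6) * Real.exp (-(lam / 50)) := by
  set E : ℝ := Real.exp (-(lam / 50)) with hE
  have hE0 : 0 < E := Real.exp_pos _
  have hmono : ∀ c : ℝ, c ≤ -(lam / 50) → Real.exp c ≤ E := fun c hc => Real.exp_le_exp.2 hc
  -- T1
  have hT1 : 1 / Real.exp (lam / 16) ≤ E := by
    rw [one_div, ← Real.exp_neg]; exact hmono _ (by linarith)
  -- J + 1 ≤ 10 e^{λ/10}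
  have hJr' : Jr ≤ 10 * Real.exp (lam / 10) := hJr.trans (three_add_le_exp lam)
  have hsqrt2 : Real.sqrt 2 ≤ 3 / 2 := by
    rw [show (3 / 2 : ℝ) = Real.sqrt ((3 / 2) ^ 2) by rw [Real.sqrt_sq (by norm_num)]]
    exact Real.sqrt_le_sqrt (by norm_num)
  -- T2: `Jr ρ ≤ 15 e^{-3λ/20}`
  have hJρ : Jr * ρ ≤ 15 * Real.exp (-(3 / 20 * lam)) := by
    have h1 : Jr * ρ ≤ (10 * Real.exp (lam / 10)) * (Real.sqrt 2 * Real.exp (-(lam / 4))) :=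
      mul_le_mul hJr' hρ hρ0 (by positivity)
    have h2 : (10 * Real.exp (lam / 10)) * (Real.sqrt 2 * Real.exp (-(lam / 4))) =
        10 * Real.sqrt 2 * Real.exp (-(3 / 20 * lam)) := by
      rw [show -(3 / 20 * lam) = lam / 10 + -(lam / 4) by ring, Real.exp_add]; ring
    rw [h2] at h1
    have h3 : 10 * Real.sqrt 2 ≤ 15 := by linarith
    exact h1.trans (mul_le_mul_of_nonneg_right h3 (Real.exp_pos _).le)
  have hJρ0 : 0 ≤ Jr * ρ := mul_nonneg hJr0 hρ0
  have hT2 : Jr * ρ ≤ 15 * E := hJρ.trans (mul_le_mul_of_nonneg_left (hmono _ (by linarith)) (by norm_num))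
  -- T3: `e^{λ/16} (Jr ρ)² ≤ 225 e^{λ/16 - 3λ/10} ≤ 225 E`
  have hT3 : Real.exp (lam / 16) * (Jr * ρ) ^ 2 ≤ 225 * E := by
    have h1 : (Jr * ρ) ^ 2 ≤ (15 * Real.exp (-(3 / 20 * lam))) ^ 2 := pow_le_pow_left₀ hJρ0 hJρ 2
    have h2 : Real.exp (lam / 16) * (15 * Real.exp (-(3 / 20 * lam))) ^ 2 =
        225 * Real.exp (lam / 16 + -(3 / 20 * lam) + -(3 / 20 * lam)) := by
      rw [Real.exp_add, Real.exp_add]; ring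
    calc Real.exp (lam / 16) * (Jr * ρ) ^ 2 ≤ Real.exp (lam / 16) * (15 * Real.exp (-(3 / 20 * lam))) ^ 2 :=
          mul_le_mul_of_nonneg_left h1 (Real.exp_pos _).le
      _ = 225 * Real.exp (lam / 16 + -(3 / 20 * lam) + -(3 / 20 * lam)) := h2
      _ ≤ 225 * E := mul_le_mul_of_nonneg_left (hmono _ (by linarith)) (by norm_num)
  -- T4: `e^{λ/16} u² ≤ 16 e^6 e^{λ/16 - 9λ/80} ≤ 16 e^6 E`
  have hT4 : Real.exp (lam / 16) * u2 ≤ 16 * Real.exp 6 * E := by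
    have h2 : Real.exp (lam / 16) * (16 * Real.exp 6 * Real.exp (-(9 / 80 * lam))) =
        16 * Real.exp 6 * Real.exp (lam / 16 + -(9 / 80 * lam)) := by
      rw [Real.exp_add]; ring
    calc Real.exp (lam / 16) * u2 ≤ Real.exp (lam / 16) * (16 * Real.exp 6 * Real.exp (-(9 / 80 * lam))) :=
          mul_le_mul_of_nonneg_left hu (Real.exp_pos _).le
      _ = 16 * Real.exp 6 * Real.exp (lam / 16 + -(9 / 80 * lam)) := h2
      _ ≤ 16 * Real.exp 6 * E := mul_le_mul_of_nonneg_left (hmono _ (by linarith)) (by positivity)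
  have hsum : Real.exp (lam / 16) * ((Jr * ρ) ^ 2 + u2) =
      Real.exp (lam / 16) * (Jr * ρ) ^ 2 + Real.exp (lam / 16) * u2 := by ring
  rw [hsum]
  have he6 : 0 ≤ Real.exp 6 := (Real.exp_pos 6).le
  nlinarith [hT1, hT2, hT3, hT4, hE0.le, he6]

/-- The decaying distance exponent at `θ = 7/10`, `δ = 0`: with `M₁ = (log log(X-1) - (7/10) log log 2X - 6)/4 - 2`,
`e^{-3M₁/2} ≤ e^6 (log X)^{-9/80}` for `X ≥ 8` (`log log(X-1) ≥ log log X - log 2`, `log log 2X ≤ log log X + log 2`).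
[folklore] -/
theorem exp_neg_threeHalves_M₁_le {X : ℝ} (hX : 8 ≤ X) :
    Real.exp (-(3 / 2 * ((Real.log (Real.log (X - 1)) - 7 / 10 * Real.log (Real.log (2 * X)) - 6) / 4 -
        (0 + 4) / 2))) ≤
      Real.exp 6 * Real.exp (-(9 / 80 * Real.log (Real.log X))) := by
  set ℓ : ℝ := Real.log X with hℓ
  have hX0 : 0 < X := by linarith
  have hlog2 : (0.6931471803 : ℝ) < Real.log 2 := Real.log_two_gt_d9
  have hlog2' : Real.log 2 < 0.6931471808 := Real.log_two_lt_d9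
  have hℓ2 : 2 ≤ ℓ := by
    have h8 : Real.log 8 = 3 * Real.log 2 := by
      rw [show (8 : ℝ) = 2 ^ 3 by norm_num, Real.log_pow]; norm_num
    have : Real.log 8 ≤ ℓ := Real.log_le_log (by norm_num) hX
    linarith
  have hℓ0 : 0 < ℓ := by linarith
  -- `log (X - 1) ≥ ℓ / 2`
  have hsqrt : Real.exp (ℓ / 2) ≤ X - 1 := by
    have hsq : Real.exp (ℓ / 2) ^ 2 = X := by
      rw [← Real.exp_nat_mul]; push_cast
      rw [show (2 : ℝ) * (ℓ / 2) = ℓ by ring, hℓ, Real.exp_log hX0]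
    nlinarith [Real.exp_pos (ℓ / 2), Real.add_one_le_exp (ℓ / 2)]
  have hA : Real.log ℓ - Real.log 2 ≤ Real.log (Real.log (X - 1)) := by
    have h1 : ℓ / 2 ≤ Real.log (X - 1) := by
      have := Real.log_le_log (Real.exp_pos _) hsqrt
      rwa [Real.log_exp] at this
    have h2 : Real.log (ℓ / 2) ≤ Real.log (Real.log (X - 1)) := Real.log_le_log (by positivity) h1
    rwa [Real.log_div hℓ0.ne' (by norm_num)] at h2
  -- `log log 2X ≤ log ℓ + log 2`
  have hB : Real.log (Real.log (2 * X)) ≤ Real.log ℓ + Real.log 2 := by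
    have h1 : Real.log (2 * X) = ℓ + Real.log 2 := by rw [Real.log_mul (by norm_num) hX0.ne', hℓ]; ring
    have h2 : Real.log (2 * X) ≤ 2 * ℓ := by rw [h1]; linarith
    have h3 : 0 < Real.log (2 * X) := by rw [h1]; linarith
    have h4 := Real.log_le_log h3 h2
    rwa [Real.log_mul (by norm_num) hℓ0.ne', add_comm] at h4
  rw [← Real.exp_add]
  refine Real.exp_le_exp.2 ?_
  nlinarith

/-- (From any Vinogradov–Korobov region `HasVKZeroFreeRegion cVK TVK`, `cVK > 0`.)  **The window `|t - t₁| ≤ (log X)^{1/16}` of Proposition A.3 for the restricted polynomial, final form.**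
Assume Khale's theorem.  There is an absolute `K` such that for all large `X`, every `0 < η ≤ 1`, every interval
system `I : SieveIntervalSystem η X₀` with `√X ≤ X₀ ≤ X` (the standing assumptions of MRT Appendix A), every completely
multiplicative `f` with `|f| ≤ 1`, every minimiser `t₁` of `u ↦ 𝔻(f, n^{iu}; X)²` over `|u| ≤ X`
(`𝔻(f, n^{it₁}; X)² ≤ M = M(f; X)`; one exists, `Halasz.Restricted.exists_isMinOn_pretentiousDistSq_twist`) and every
`[a, b] ⊆ [t₁ - (log X)^{1/16}, t₁ + (log X)^{1/16}] ∩ [-X/2, X/2]`,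

`∫_a^b |F(1+it)|² dt ≤ K ((1 + M) e^{-M/2} + (log X)^{-1/50})`,  `F(1+it) = MRT2015.restrDirichlet f I X t`.

This is the contribution of `𝒯₀ ∪ 𝒯₁ = [0, T] ∩ {|t - t₁| ≤ (log X)^{1/16}}` (`T ≤ X/2`) to
`MRT2015.PropA3With (fun M => C (1 + M) e^{-M/2})`; the remaining range `𝒯₂` is Lemma A.4 / MR §8 for restricted sums.
[cite: MatomakiRadziwillTao2015, Appendix A, Proposition A.3 (proof)] [cite: Khale2024, Theorem 1.1] -/
theorem integral_sq_restrDirichlet_window_le_of_vk {cVK TVK : ℝ} (hcVK : 0 < cVK) (hVK : HasVKZeroFreeRegion cVK TVK) :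
    ∃ K : ℝ, 0 < K ∧ ∀ᶠ X : ℝ in atTop, ∀ (η X₀ : ℝ) (I : SieveIntervalSystem η X₀) (f : ℕ → ℂ),
      0 < η → η ≤ 1 → (∀ m n, f (m * n) = f m * f n) → f 1 = 1 → (∀ n, ‖f n‖ ≤ 1) →
      Real.sqrt X ≤ X₀ → X₀ ≤ X →
      ∀ (t₁ a b : ℝ),
        pretentiousDistSq f (fun n : ℕ => (n : ℂ) ^ ((t₁ : ℂ) * Complex.I)) X ≤ minPretentiousDistSq f X X →
        a ≤ b → t₁ - Real.log X ^ (1 / 16 : ℝ) ≤ a → b ≤ t₁ + Real.log X ^ (1 / 16 : ℝ) →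
        -(X / 2) ≤ a → b ≤ X / 2 →
        ∫ t in a..b, ‖restrDirichlet f I X t‖ ^ 2 ≤
          K * ((1 + minPretentiousDistSq f X X) * Real.exp (-minPretentiousDistSq f X X / 2) +
            1 / Real.log X ^ (1 / 50 : ℝ)) := by
  obtain ⟨K, hK0, hW⟩ := Halasz.Restricted.integral_sq_restr_dirichlet_window_le_of_vk hcVK hVK
    (θ := 7 / 10) (by norm_num) (by norm_num)
  refine ⟨K * (250 + 16 * Real.exp 6), by positivity, ?_⟩
  filter_upwards [hW, eventually_ge_atTop (64 : ℝ), Real.tendsto_log_atTop.eventually_ge_atTop (5 : ℝ),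
    (Real.tendsto_log_atTop.comp Real.tendsto_log_atTop).eventually_ge_atTop (48 : ℝ)] with X hWX hX64 hℓ5 hll
  intro η X₀ I f hη hη1 hf hf1 hfb hX₀ hX₀X t₁ a b hmin hab ha hb haX hbX
  clear hW
  have hη8 : η ≤ 8 := by linarith
  have hX0 : 0 < X := by linarith
  set ℓ : ℝ := Real.log X with hℓdef
  set lam : ℝ := Real.log ℓ with hlamdef
  have hlam48 : 48 ≤ lam := hll
  have hℓ0 : 0 < ℓ := by linarith
  have hℓ1 : 1 ≤ ℓ := by linarith
  have hℓ4 : 4 ≤ ℓ := by linarith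
  have hlam0 : 0 ≤ lam := by linarith
  -- the window length
  set L : ℝ := ℓ ^ (1 / 16 : ℝ) with hLdef
  have hLexp : L = Real.exp (lam / 16) := by
    rw [hLdef, Real.rpow_def_of_pos hℓ0, hlamdef]; ring_nf
  have he3 : (16 : ℝ) ≤ Real.exp 3 := by
    have h := Real.exp_one_gt_d9
    have h3 : Real.exp 3 = Real.exp 1 ^ 3 := by rw [← Real.exp_nat_mul]; norm_num
    have h4 : (2.7182818283 : ℝ) ^ 3 ≤ Real.exp 1 ^ 3 := pow_le_pow_left₀ (by norm_num) h.le 3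
    rw [h3]; exact le_trans (by norm_num) h4
  have h16L : 16 ≤ L := by
    rw [hLexp]; exact he3.trans (Real.exp_le_exp.2 (by linarith))
  have hLX : L ≤ X / 4 := by
    have h1 : L ≤ ℓ := by
      rw [hLdef]
      calc ℓ ^ (1 / 16 : ℝ) ≤ ℓ ^ (1 : ℝ) := Real.rpow_le_rpow_of_exponent_le hℓ1 (by norm_num)
        _ = ℓ := Real.rpow_one ℓ
    have h2 : ℓ ≤ X ^ (1 / 2 : ℝ) / (1 / 2) := Real.log_le_rpow_div hX0.le (by norm_num)
    have h3 : X ^ (1 / 2 : ℝ) ≤ X / 8 := by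
      rw [← Real.sqrt_eq_rpow]
      have hs8 : 8 ≤ Real.sqrt X := by
        rw [show (8 : ℝ) = Real.sqrt 64 by rw [show (64:ℝ) = 8 ^ 2 by norm_num, Real.sqrt_sq (by norm_num)]]
        exact Real.sqrt_le_sqrt hX64
      nlinarith [Real.mul_self_sqrt hX0.le, Real.sqrt_nonneg X]
    have : ℓ ≤ X / 4 := by rw [le_div_iff₀ (by norm_num)] at h2 ⊢; linarith
    exact h1.trans this
  -- the block system of `I` and the bound `Q = exp(√ log X)`
  set Q : ℝ := Real.exp (Real.sqrt ℓ) with hQdef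
  have hs2 : 2 ≤ Real.sqrt ℓ := by
    rw [show (2 : ℝ) = Real.sqrt 4 by rw [show (4:ℝ) = 2 ^ 2 by norm_num, Real.sqrt_sq (by norm_num)]]
    exact Real.sqrt_le_sqrt hℓ4
  have hQ2 : Real.exp 2 ≤ Q := Real.exp_le_exp.2 hs2
  have hsX : 0 < Real.sqrt X := Real.sqrt_pos.2 hX0
  have hX₀0 : 0 < X₀ := hsX.trans_le hX₀
  have hQJ : I.Q I.J ≤ Q :=
    I.Q_J_le.trans (Real.exp_le_exp.2 (Real.sqrt_le_sqrt (Real.log_le_log hX₀0 hX₀X)))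
  have hQX1 : Q ≤ X - 1 := by
    have h1 : Real.sqrt ℓ ≤ ℓ / 2 := by nlinarith [Real.mul_self_sqrt hℓ0.le, Real.sqrt_nonneg ℓ]
    have h2 : Real.exp (ℓ / 2) = Real.sqrt X := by
      rw [Real.sqrt_eq_rpow, Real.rpow_def_of_pos hX0, hℓdef]; ring_nf
    have h3 : Real.sqrt X ≤ X - 1 := by
      have hs8 : 8 ≤ Real.sqrt X := by
        rw [show (8 : ℝ) = Real.sqrt 64 by rw [show (64:ℝ) = 8 ^ 2 by norm_num, Real.sqrt_sq (by norm_num)]]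
        exact Real.sqrt_le_sqrt hX64
      nlinarith [Real.mul_self_sqrt hX0.le]
    calc Q ≤ Real.exp (ℓ / 2) := Real.exp_le_exp.2 h1
      _ = Real.sqrt X := h2
      _ ≤ X - 1 := h3
  have hN : I.Q I.J ≤ ((⌈X⌉₊ - 1 : ℕ) : ℝ) := by
    have h1 : 1 ≤ ⌈X⌉₊ := Nat.one_le_iff_ne_zero.2 (by simpa using hX0)
    rw [Nat.cast_sub h1, Nat.cast_one]
    have h2 : X ≤ ⌈X⌉₊ := Nat.le_ceil X
    linarith
  have hsys := isBlockSystem I hη hη8 hN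
  have hblkQ : ∀ i ∈ Finset.Icc 1 I.J, ∀ p ∈ (Finset.Icc ⌈I.P i⌉₊ ⌊I.Q i⌋₊).filter Nat.Prime, (p : ℝ) ≤ Q :=
    fun i hi p hp => (primeBlock_le_Q_J I hη hη8 i hi p hp).trans hQJ
  have hmin0 : pretentiousDistSq f (fun n : ℕ => (n : ℂ) ^ ((t₁ : ℂ) * Complex.I)) X ≤
      minPretentiousDistSq f X X + 0 := by linarith
  have hmain := hWX (Finset.Icc 1 I.J) (fun j => (Finset.Icc ⌈I.P j⌉₊ ⌊I.Q j⌋₊).filter Nat.Prime) f hf hf1 hfb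
    Q t₁ 0 L a b hQ2 le_rfl hsys hblkQ le_rfl hmin0 h16L hLX hab ha hb haX hbX
  have hEq : ∀ t : ℝ, restrDirichlet f I X t = ∑ n ∈ (Finset.Icc ⌈X⌉₊ ⌊2 * X⌋₊).filter
      (MemBlocks (Finset.Icc 1 I.J) (fun j => (Finset.Icc ⌈I.P j⌉₊ ⌊I.Q j⌋₊).filter Nat.Prime)),
        f n * (n : ℂ) ^ (-(1 + (t : ℂ) * Complex.I)) := fun t => restrDirichlet_eq_sum_memBlocks f I hX0 t
  simp_rw [hEq]
  refine hmain.trans ?_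
  clear hmain hEq hWX hsys hblkQ hmin0 hN
  -- the error terms
  set M : ℝ := minPretentiousDistSq f X X with hMdef
  set P : ℝ := (1 + M) * Real.exp (-M / 2) with hPdef
  set M₁ : ℝ := (Real.log (Real.log (X - 1)) - 7 / 10 * Real.log (Real.log (2 * X)) - 6) / 4 - (0 + 4) / 2
    with hM₁def
  set u : ℝ := (1 + max 0 M₁) * Real.exp (-max 0 M₁) with hudef
  set ρ : ℝ := Real.sqrt ((Real.log Q + 2) / ℓ) with hρdef
  set Jr : ℝ := ((Finset.Icc 1 I.J).card : ℝ) + 1 with hJrdef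
  have hP0 : 0 ≤ P := by
    have : 0 ≤ M := minPretentiousDistSq_nonneg hfb X hX0.le
    positivity
  have hJr0 : 0 ≤ Jr := by positivity
  have hJr : Jr ≤ 3 + lam := by
    have hcard : ((Finset.Icc 1 I.J).card : ℝ) = I.J := by rw [Nat.card_Icc]; simp
    have hexp2 : Real.exp 1 ^ 2 ≤ X :=
      le_trans (le_trans (pow_le_pow_left₀ (Real.exp_pos 1).le Real.exp_one_lt_d9.le 2) (by norm_num)) hX64
    have he1 : Real.exp 1 ≤ X₀ := by
      refine le_trans ?_ hX₀
      rw [← Real.sqrt_sq (Real.exp_pos 1).le]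
      exact Real.sqrt_le_sqrt hexp2
    have h1 := J_add_one_le I hη hη1 he1
    have h2 : Real.log (Real.log X₀) ≤ lam := by
      have hX₀1 : 1 ≤ Real.log X₀ := by
        rw [← Real.log_exp 1]; exact Real.log_le_log (Real.exp_pos 1) he1
      exact Real.log_le_log (by linarith) (Real.log_le_log hX₀0 hX₀X)
    rw [hJrdef, hcard]; linarith
  have hρ0 : 0 ≤ ρ := Real.sqrt_nonneg _
  have hρ : ρ ≤ Real.sqrt 2 * Real.exp (-(lam / 4)) := by
    rw [hρdef, hQdef, Real.log_exp]; exact sqrt_ratio_le hℓ4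
  have hu : u ^ 2 ≤ 16 * Real.exp 6 * Real.exp (-(9 / 80 * lam)) := by
    have h1 := sq_one_add_mul_exp_neg_le (le_max_left 0 M₁)
    have h2 : Real.exp (-(3 / 2 * max 0 M₁)) ≤ Real.exp (-(3 / 2 * M₁)) :=
      Real.exp_le_exp.2 (by linarith [le_max_right 0 M₁])
    have h3 := exp_neg_threeHalves_M₁_le (by linarith : (8 : ℝ) ≤ X)
    rw [hudef]
    calc ((1 + max 0 M₁) * Real.exp (-max 0 M₁)) ^ 2 ≤ 16 * Real.exp (-(3 / 2 * max 0 M₁)) := h1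
      _ ≤ 16 * Real.exp (-(3 / 2 * M₁)) := by linarith
      _ ≤ 16 * (Real.exp 6 * Real.exp (-(9 / 80 * lam))) := by
          refine mul_le_mul_of_nonneg_left ?_ (by norm_num)
          simpa only [hM₁def, hlamdef, hℓdef] using h3
      _ = 16 * Real.exp 6 * Real.exp (-(9 / 80 * lam)) := by ring
  have herr := window_errTerms_le hlam0 hJr0 hJr hρ0 hρ hu
  have hE : Real.exp (-(lam / 50)) = 1 / ℓ ^ (1 / 50 : ℝ) := by
    rw [Real.rpow_def_of_pos hℓ0, one_div, ← Real.exp_neg, hlamdef]; ring_nf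
  rw [hLexp]
  rw [hE] at herr
  have hiE : 0 ≤ 1 / ℓ ^ (1 / 50 : ℝ) := by positivity
  have hC : (1 : ℝ) ≤ 250 + 16 * Real.exp 6 := by have := Real.exp_pos 6; linarith
  -- `K (P + T) ≤ K (250 + 16e⁶) (P + E)`
  have hT : 1 / Real.exp (lam / 16) + Jr * ρ + Real.exp (lam / 16) * ((Jr * ρ) ^ 2 + u ^ 2) ≤
      (250 + 16 * Real.exp 6) * (1 / ℓ ^ (1 / 50 : ℝ)) := herr
  have hPC : P ≤ (250 + 16 * Real.exp 6) * P := le_mul_of_one_le_left hP0 hC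
  calc K * (P + 1 / Real.exp (lam / 16) + Jr * ρ + Real.exp (lam / 16) * ((Jr * ρ) ^ 2 + u ^ 2))
      = K * (P + (1 / Real.exp (lam / 16) + Jr * ρ + Real.exp (lam / 16) * ((Jr * ρ) ^ 2 + u ^ 2))) := by ring
    _ ≤ K * ((250 + 16 * Real.exp 6) * P + (250 + 16 * Real.exp 6) * (1 / ℓ ^ (1 / 50 : ℝ))) := by
        refine mul_le_mul_of_nonneg_left ?_ hK0.le
        linarith
    _ = K * (250 + 16 * Real.exp 6) * (P + 1 / ℓ ^ (1 / 50 : ℝ)) := by ring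

/-- **The window `|t - t₁| ≤ (log X)^{1/16}` of Proposition A.3 for the restricted polynomial, final form.**
Assume Khale's theorem.  There is an absolute `K` such that for all large `X`, every `0 < η ≤ 1`, every interval
system `I : SieveIntervalSystem η X₀` with `√X ≤ X₀ ≤ X` (the standing assumptions of MRT Appendix A), every completely
multiplicative `f` with `|f| ≤ 1`, every minimiser `t₁` of `u ↦ 𝔻(f, n^{iu}; X)²` over `|u| ≤ X`
(`𝔻(f, n^{it₁}; X)² ≤ M = M(f; X)`; one exists, `Halasz.Restricted.exists_isMinOn_pretentiousDistSq_twist`) and every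
`[a, b] ⊆ [t₁ - (log X)^{1/16}, t₁ + (log X)^{1/16}] ∩ [-X/2, X/2]`,

`∫_a^b |F(1+it)|² dt ≤ K ((1 + M) e^{-M/2} + (log X)^{-1/50})`,  `F(1+it) = MRT2015.restrDirichlet f I X t`.

This is the contribution of `𝒯₀ ∪ 𝒯₁ = [0, T] ∩ {|t - t₁| ≤ (log X)^{1/16}}` (`T ≤ X/2`) to
`MRT2015.PropA3With (fun M => C (1 + M) e^{-M/2})`; the remaining range `𝒯₂` is Lemma A.4 / MR §8 for restricted sums.
[cite: MatomakiRadziwillTao2015, Appendix A, Proposition A.3 (proof)] [cite: Khale2024, Theorem 1.1] -/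
theorem integral_sq_restrDirichlet_window_le (hK : Khale2024_zeroFreeRegion) :
    ∃ K : ℝ, 0 < K ∧ ∀ᶠ X : ℝ in atTop, ∀ (η X₀ : ℝ) (I : SieveIntervalSystem η X₀) (f : ℕ → ℂ),
      0 < η → η ≤ 1 → (∀ m n, f (m * n) = f m * f n) → f 1 = 1 → (∀ n, ‖f n‖ ≤ 1) →
      Real.sqrt X ≤ X₀ → X₀ ≤ X →
      ∀ (t₁ a b : ℝ),
        pretentiousDistSq f (fun n : ℕ => (n : ℂ) ^ ((t₁ : ℂ) * Complex.I)) X ≤ minPretentiousDistSq f X X →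
        a ≤ b → t₁ - Real.log X ^ (1 / 16 : ℝ) ≤ a → b ≤ t₁ + Real.log X ^ (1 / 16 : ℝ) →
        -(X / 2) ≤ a → b ≤ X / 2 →
        ∫ t in a..b, ‖restrDirichlet f I X t‖ ^ 2 ≤
          K * ((1 + minPretentiousDistSq f X X) * Real.exp (-minPretentiousDistSq f X X / 2) +
            1 / Real.log X ^ (1 / 50 : ℝ))  :=
  integral_sq_restrDirichlet_window_le_of_vk (by norm_num) (hasVKZeroFreeRegion_of_khale hK)

end MRT2015

end Literature.NumberTheory.LFunctions

end
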